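import Summits.AnomalousDissipation.AnomalousDissipation.Theorems.BaireTransferRobustLoudUpgradeTemperedClosed
import Summits.AnomalousDissipation.AnomalousDissipation.Theorems.BaireTransferRobustLoudUpgradeStubFsigmaMeagre
import Summits.AnomalousDissipation.AnomalousDissipation.Theorems.BaireTransferRobustLoudUpgradeStubCategoryTransfer

/-!
# The loud set is `F_σ`: category of the upgrade for ALL witnesses, the crux ⟺ local non-meagreness, and the route door R5
# (crux `BaireTransfer.RobustLoudUpgrade`, stmt-AnomalousDissipation-1144; line `malkin-cone-group-orbits`, lead c16)

Sequel of `…RobustLoudUpgradeTemperedClosed.lean` (lattice-tempered windows are closed; `loud S a E ε` is `F_σ`,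
`exists_isClosed_iUnion_eq_loud`).  Consequences, all unconditional:

* §1 pointwise category transfer for `F_σ` sets (`mem_closure_interior_of_not_isMeagre`, any space; converse in Baire spaces);
* §2 **`isMeagre_loud_diff_interior`** — for every `S`, `a > 0`, `E`, `ε` the loud forces that are not INTERIOR points of the SAME
  (sharp-budget) loud set form a MEAGRE subset of `P_S`: the c15 category package (steady leaf, `…RobustLoudUpgradeCategory*.lean`)
  extended to genuinely time-periodic witnesses of any mean; hence the crux's inclusion `LOUD_j(E,ε) ⊆ closure (interior LOUD_j(2E,ε/2))`
  fails at most on a meagre set (`isMeagre_loud_diff_closure_interior_relaxed`); the c4 `category_transfer` with its `F_σ` hypothesis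
  discharged (`category_transfer_loud`); the pointwise form `mem_closure_interior_loud_iff`;
* §3 **`crux_iff_locallyNonMeagreLoud`** — the crux-strategist's split D5 (`Cruxes/RobustLoudUpgrade/STRATEGY-CENSUS.md`,
  `RobustLoudUpgrade_of_subs` + `locallyNonMeagreLoud_of_crux`) with Sub₀ and Sub₁ DISCHARGED: `RobustLoudUpgrade` ⟺ relaxed loudness
  is non-meagre in every open neighbourhood of every loud force (the registered residual `stub_residual_c16` of skeleton c16);
  **`baireTarget_iff_locallyNonMeagre`** — the route's target ⟺ local second category of `LOUD_j` at every level on some open `U`;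
* §4 **the route-level door R5** (census §7) unconditional: `all_loud_of_denseLatticeTempered`, `baireTarget_of_denseLatticeTempered` —
  if crux #2's designer witnesses near `U` sit, level by level, in ONE lattice-tempered window, then every force of `U` is loud at every
  level and `BaireTarget` holds with no upgrade, no genericity, no Baire step.

References: census v3 `Cruxes/RobustLoudUpgrade/STRATEGY-CENSUS.md` (§D5, §7 R5) and its companion
`StrategyCensusTemperedWindows.lean` (planner-cstrat-…-1144-s1-0); J. C. Oxtoby, *Measure and Category* (2nd ed., 1980) Ch. 9
(Baire category, `F_σ` sets); M. K. Fort, Publ. Math. Debrecen 2 (1951) (the c15 genericity tool, not used here).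
-/

set_option linter.dupNamespace false

noncomputable section

open scoped BigOperators Topology ENNReal NNReal ComplexConjugate
open Filter Set Function TopologicalSpace MeasureTheory UnitAddTorus

namespace Summit.AnomalousDissipation.AnomalousDissipation.Theorems.RobustLoudUpgrade.Tempered

open Literature.Analysis.FunctionSpaces Literature.Analysis.FunctionSpaces.Torus
open Literature.Analysis.FunctionSpaces.EuclideanSpace
open Literature.Analysis.FluidPDE Literature.Analysis.FluidPDE.ScalarFourier
open Literature.Analysis.FluidPDE.TimePeriodicLattice
open Summit.AnomalousDissipation.AnomalousDissipation.Theses.BaireTransfer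
open Summit.AnomalousDissipation.AnomalousDissipation.Theorems.RobustLoudUpgrade

-- NOTATION START (verbatim the local notations of `Literature/Analysis/FluidPDE/PeriodicNSOrbitPersistsProofs.lean`)
/-- The flat unit torus `T³`. -/
local notation "𝕋³" => UnitAddTorus (Fin 3)
/-- Real velocity values. -/
local notation "ℝ³" => EuclideanSpace ℝ (Fin 3)
/-- Complex coefficient values. -/
local notation "ℂ³" => EuclideanSpace ℂ (Fin 3)

/-- Local notation: the parabolic weight `Λ(n, k) = |n| + |k|²`. -/
local notation:max "Λ" m:max => (|((Prod.fst m : ℤ) : ℝ)| + freqNormSq (Prod.snd m))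

/-- Local notation: the convective symbol on `ℤ × ℤ³` (as in `TimePeriodicNSLattice`). -/
local notation:max "𝐍[" a ", " b "]" m:max =>
  (WithLp.toLp 2 (fun p : Fin 3 => ∑ j : Fin 3, ∑' m' : ℤ × (Fin 3 → ℤ),
    a m' j * (dsym j (Prod.snd m - Prod.snd m') * b (m - m') p)) : EuclideanSpace ℂ (Fin 3))

/-- Local notation: division by the weight. -/
local notation:max "𝐜" x:max => (fun mm : ℤ × (Fin 3 → ℤ) =>
  ((((|((Prod.fst mm : ℤ) : ℝ)| + freqNormSq (Prod.snd mm))⁻¹ : ℝ) : ℂ) • x mm))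

/-- Local notation: multiplication by the weight. -/
local notation:max "𝐬" x:max => (fun mm : ℤ × (Fin 3 → ℤ) =>
  ((((|((Prod.fst mm : ℤ) : ℝ)| + freqNormSq (Prod.snd mm)) : ℝ) : ℂ) • x mm))

/-- Local notation: the family of coefficients of `x ∈ W ⊂ ℓ²`. -/
local notation:max "𝐰" x:max =>
  (((x : lp (fun _ : ℤ × (Fin 3 → ℤ) => EuclideanSpace ℂ (Fin 3)) 2)) : ℤ × (Fin 3 → ℤ) → EuclideanSpace ℂ (Fin 3))

/-- Local notation: the symbol `σ_om(n,k) = 2πi om n + 4π²ν|k|² + 2πi m₀·k`. -/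
local notation "σ[" om ", " ν ", " m₀ "]" => (fun mm : ℤ × (Fin 3 → ℤ) =>
  2 * Real.pi * Complex.I * ((om : ℝ) : ℂ) * ((Prod.fst mm : ℤ) : ℂ) +
    (((4 * Real.pi ^ 2 * ν * freqNormSq (Prod.snd mm) : ℝ)) : ℂ) +
    2 * Real.pi * Complex.I * (∑ jj : Fin 3, ((m₀ jj : ℝ) : ℂ) * (((Prod.snd mm) jj : ℤ) : ℂ)))

/-- Local notation: the lattice family of the orbit `u` with period `τ`:
`û(n,k) = 𝓕(complexify ∘ (timeRoll τ u − ∫ u(0)))(n,k)`. -/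
local notation:max "𝐨[" τ ", " u "]" => (fun mm : ℤ × (Fin 3 → ℤ) =>
  mFourierCoeff (EuclideanSpace.complexify ∘ fun y : UnitAddTorus (Fin 4) => Torus.timeRoll τ u y - ∫ x, u 0 x)
    (Fin.cons (Prod.fst mm) (Prod.snd mm) : Fin 4 → ℤ))

/-- Local notation: the force family `y_F(n,k) = [k ≠ 0][n = 0] 𝓕(complexify ∘ F)(k)`. -/
local notation:max "𝐲" F:max => (fun mm : ℤ × (Fin 3 → ℤ) =>
  (ite (Prod.snd mm = 0) (0 : EuclideanSpace ℂ (Fin 3))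
    (ite (Prod.fst mm = 0) (mFourierCoeff (EuclideanSpace.complexify ∘ F) (Prod.snd mm)) 0)))
-- NOTATION END

/-! ## §1 Pointwise category transfer for `F_σ` sets (any space / Baire spaces) -/

section Transfer

/-- A closed piece `K ⊆ L` traced on a set `V` missing `interior L` is nowhere dense. [folklore] -/
theorem isNowhereDense_inter {X : Type*} [TopologicalSpace X] {L K V : Set X}
    (hdis : interior L ∩ V = ∅) (hK : IsClosed K) (hKL : K ⊆ L) :
    IsNowhereDense (K ∩ V) := by
  rw [IsNowhereDense]
  apply Set.eq_empty_of_forall_notMem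
  intro y hy
  have h1 : interior (closure (K ∩ V)) ⊆ interior K :=
    interior_mono ((closure_mono Set.inter_subset_left).trans hK.closure_subset)
  have hyL : y ∈ interior L := interior_mono hKL (h1 hy)
  have hyV : y ∈ closure V :=
    (interior_subset.trans (closure_mono Set.inter_subset_right)) hy
  obtain ⟨z, hzL, hzV⟩ := mem_closure_iff.1 hyV (interior L) isOpen_interior hyL
  have : z ∈ interior L ∩ V := ⟨hzL, hzV⟩
  rw [hdis] at this
  exact this

/-- **Pointwise category lemma (any space)**: if `L = ⋃ₙ Kₙ` with all `Kₙ` closed and `L` is non-meagre in every open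
neighbourhood of `c`, then `c ∈ closure (interior L)`. [folklore] -/
theorem mem_closure_interior_of_not_isMeagre {X : Type*} [TopologicalSpace X] {L : Set X} {K : ℕ → Set X}
    (hK : ∀ n, IsClosed (K n)) (hL : L = ⋃ n, K n) {c : X}
    (h : ∀ V : Set X, IsOpen V → c ∈ V → ¬ IsMeagre (L ∩ V)) : c ∈ closure (interior L) := by
  by_contra hc
  set V : Set X := (closure (interior L))ᶜ with hV
  have hVo : IsOpen V := isClosed_closure.isOpen_compl
  have hcV : c ∈ V := hc
  have hdis : interior L ∩ V = ∅ :=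
    Set.eq_empty_of_forall_notMem fun y hy => hy.2 (subset_closure hy.1)
  have hmeag : IsMeagre (L ∩ V) := by
    have e : L ∩ V = ⋃ n, (K n ∩ V) := by rw [hL, Set.iUnion_inter]
    rw [e]
    exact isMeagre_iUnion fun n =>
      (isNowhereDense_inter hdis (hK n) (hL ▸ Set.subset_iUnion K n)).isMeagre
  exact h V hVo hcV hmeag

/-- **Pointwise category lemma, converse (Baire spaces)**: if `c ∈ closure (interior L)` then `L` is non-meagre in every open
neighbourhood of `c` (a non-empty open subset of the Baire space is not meagre). [folklore] -/
theorem not_isMeagre_inter_of_mem_closure_interior {X : Type*} [TopologicalSpace X] [BaireSpace X] {L : Set X} {c : X}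
    (h : c ∈ closure (interior L)) {V : Set X} (hVo : IsOpen V) (hcV : c ∈ V) : ¬ IsMeagre (L ∩ V) := by
  intro hmeag
  obtain ⟨y, hyV, hyL⟩ := mem_closure_iff.1 h V hVo hcV
  have hWo : IsOpen (V ∩ interior L) := hVo.inter isOpen_interior
  have hne : (V ∩ interior L).Nonempty := ⟨y, hyV, hyL⟩
  have hsub : V ∩ interior L ⊆ L ∩ V := fun z hz => ⟨interior_subset hz.2, hz.1⟩
  exact not_isMeagre_of_isOpen hWo hne (hmeag.mono hsub)

end Transfer

/-! ## §2 Category of the loud set for ALL witnesses (sharp budgets, interior, no stock) -/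

section Category

variable (S : Finset (Fin 3 → ℤ)) {a : ℝ} (E ε : ℝ)

/-- **THE UPGRADE HOLDS OFF A MEAGRE SET, FOR ALL WITNESSES AND SHARP BUDGETS**: for every finite family `S`, ceiling `a > 0` and
budgets `E, ε`, the loud forces that are NOT interior points of the (same, sharp) loud set form a MEAGRE subset of `P_S` — the c15
category package (`Category.isMeagre_loudSteadyLeaf_diff_interior_loud`, steady leaf) extended to genuinely time-periodic witnesses of
any mean: `loud` itself is `F_σ` (`exists_isClosed_iUnion_eq_loud`) and an `F_σ` set minus its interior is meagre
(`Category.stub_fsigma_meagre`). [folklore] -/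
theorem isMeagre_loud_diff_interior (ha : 0 < a) : IsMeagre (loud S a E ε \ interior (loud S a E ε)) := by
  obtain ⟨K, hK, hL⟩ := exists_isClosed_iUnion_eq_loud S a E ε ha
  rw [hL]
  exact Category.stub_fsigma_meagre K hK

/-- The relaxed loud set contains the sharp one when `0 ≤ ε` (`0 ≤ meanEnergy ≤ E` forces `E ≤ 2E`). [folklore] -/
theorem loud_subset_loud_relaxed (hε : 0 ≤ ε) : loud S a E ε ⊆ loud S a (2 * E) (ε / 2) := by
  rintro c ⟨ν, hν, hνa, τ, u, p, hτ, hsol, hper, hE, hεu⟩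
  have hE0 : 0 ≤ E := (meanEnergy_nonneg u).trans hE
  refine ⟨ν, hν, hνa, τ, u, p, hτ, hsol, hper, ?_, ?_⟩ <;> linarith

/-- **The crux's inclusion fails at most on a meagre set**: at every level `j` and all budgets with `0 ≤ ε`, the set of loud forces
OUTSIDE `closure (interior LOUD_j(S,2E,ε/2))` — the would-be counterexamples to `RobustLoudUpgrade` in the family `P_S` — is meagre
(indeed contained in `LOUD_j(S,E,ε) ∖ interior LOUD_j(S,E,ε)`). [folklore] -/
theorem isMeagre_loud_diff_closure_interior_relaxed (hε : 0 ≤ ε) (j : ℕ) :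
    IsMeagre (loud S (1 / ((j : ℝ) + 1)) E ε \ closure (interior (loud S (1 / ((j : ℝ) + 1)) (2 * E) (ε / 2)))) := by
  have ha : (0 : ℝ) < 1 / ((j : ℝ) + 1) := one_div_pos.2 (by positivity)
  refine (isMeagre_loud_diff_interior S E ε ha).mono ?_
  intro c hc
  exact ⟨hc.1, fun h => hc.2 ((interior_mono (loud_subset_loud_relaxed S E ε hε)).trans subset_closure h)⟩

/-- **Pointwise category form of the obligation** (`0 < a`): `c ∈ closure (interior (loud S a E ε))` iff the loud set is non-meagre
in every open neighbourhood of `c`. [folklore] -/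
theorem mem_closure_interior_loud_iff (ha : 0 < a) (c : Coeff S) :
    c ∈ closure (interior (loud S a E ε)) ↔ ∀ V : Set (Coeff S), IsOpen V → c ∈ V → ¬ IsMeagre (loud S a E ε ∩ V) := by
  obtain ⟨K, hK, hL⟩ := exists_isClosed_iUnion_eq_loud S a E ε ha
  exact ⟨fun h V hVo hcV => not_isMeagre_inter_of_mem_closure_interior h hVo hcV,
    mem_closure_interior_of_not_isMeagre hK hL⟩

/-- **`category_transfer` UNCONDITIONALLY** (the c4 companion's registered sub-goal had the `F_σ` property of `loud` as a hypothesis; it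
is now discharged): for open `U ⊆ P_S` and `0 < a`, `U ⊆ closure (interior (loud S a E ε))` iff `loud S a E ε` is non-meagre in every
non-empty open subset of `U`. [folklore] -/
theorem category_transfer_loud (ha : 0 < a) {U : Set (Coeff S)} (hU : IsOpen U) :
    U ⊆ closure (interior (loud S a E ε)) ↔
      ∀ V : Set (Coeff S), IsOpen V → V.Nonempty → V ⊆ U → ¬ IsMeagre (loud S a E ε ∩ V) := by
  obtain ⟨K, hK, hL⟩ := exists_isClosed_iUnion_eq_loud S a E ε ha
  exact CategoryTransfer.category_transfer S a E ε K U hK hL hU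

end Category

/-! ## §3 The crux and the route's target in Baire-largeness language (census D5, now unconditional) -/

/-- **THE CRUX ⟺ LOCAL NON-MEAGRENESS OF RELAXED LOUDNESS** (census D5's `RobustLoudUpgrade_of_subs` and `locallyNonMeagreLoud_of_crux`
with Sub₀, Sub₁ discharged): `RobustLoudUpgrade` holds iff for some finite stock `S₀`, in every family `S ⊇ S₀`, at all budgets with
`0 < ε` and every level, the relaxed loud set `LOUD_j(S,2E,ε/2)` is NON-MEAGRE in every open neighbourhood of every point of
`LOUD_j(S,E,ε)`.  This is the honest residual of the reshape c16 (registered stub `stub_residual_c16`). [folklore] -/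
theorem crux_iff_locallyNonMeagreLoud :
    RobustLoudUpgrade ↔
      ∃ S₀ : Finset (Fin 3 → ℤ), ∀ S : Finset (Fin 3 → ℤ), S₀ ⊆ S → ∀ (E ε : ℝ), 0 < ε → ∀ j : ℕ,
        ∀ c ∈ loud S (1 / ((j : ℝ) + 1)) E ε, ∀ V : Set (Coeff S), IsOpen V → c ∈ V →
          ¬ IsMeagre (loud S (1 / ((j : ℝ) + 1)) (2 * E) (ε / 2) ∩ V) := by
  constructor
  · rintro ⟨S₀, hS₀⟩
    refine ⟨S₀, fun S hS E ε hε j c hc V hVo hcV => ?_⟩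
    have ha : (0 : ℝ) < 1 / ((j : ℝ) + 1) := one_div_pos.2 (by positivity)
    exact (mem_closure_interior_loud_iff S (2 * E) (ε / 2) ha c).1 (hS₀ S hS E ε hε j hc) V hVo hcV
  · rintro ⟨S₀, hS₀⟩
    refine ⟨S₀, fun S hS E ε hε j c hc => ?_⟩
    have ha : (0 : ℝ) < 1 / ((j : ℝ) + 1) := one_div_pos.2 (by positivity)
    exact (mem_closure_interior_loud_iff S (2 * E) (ε / 2) ha c).2 (hS₀ S hS E ε hε j c hc)

/-- **THE ROUTE'S TARGET ⟺ LOCAL SECOND CATEGORY OF LOUDNESS AT EVERY LEVEL**: `BaireTarget` holds iff there are a family `S`,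
budgets `E`, `ε > 0` and a non-empty open `U ⊆ P_S` such that at every level `j` the loud set `LOUD_j(S,E,ε)` is non-meagre in
every non-empty open subset of `U` (the route's `LOUD_j` is `loud S (1/(j+1)) E ε` by `rfl`). [folklore] -/
theorem baireTarget_iff_locallyNonMeagre :
    BaireTarget ↔
      ∃ (S : Finset (Fin 3 → ℤ)) (E ε : ℝ), 0 < ε ∧ ∃ U : Set (Coeff S), IsOpen U ∧ U.Nonempty ∧
        ∀ j : ℕ, ∀ V : Set (Coeff S), IsOpen V → V.Nonempty → V ⊆ U →
          ¬ IsMeagre (loud S (1 / ((j : ℝ) + 1)) E ε ∩ V) := by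
  constructor
  · rintro ⟨S, E, ε, hε, U, hUo, hUne, hU⟩
    refine ⟨S, E, ε, hε, U, hUo, hUne, fun j => ?_⟩
    have ha : (0 : ℝ) < 1 / ((j : ℝ) + 1) := one_div_pos.2 (by positivity)
    exact (category_transfer_loud S E ε ha hUo).1 (hU j)
  · rintro ⟨S, E, ε, hε, U, hUo, hUne, hU⟩
    refine ⟨S, E, ε, hε, U, hUo, hUne, fun j => ?_⟩
    have ha : (0 : ℝ) < 1 / ((j : ℝ) + 1) := one_div_pos.2 (by positivity)
    exact (category_transfer_loud S E ε ha hUo).2 (hU j)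

/-! ## §4 The route-level door R5 (census §7), unconditional: uniformly tempered dense designer witnesses make the upgrade (and
Baire) disappear -/

/-- **R5, strong form**: if for every stock `S₀` there are `S ⊇ S₀`, budgets and a non-empty open `U` such that at every level `j` ONE
standard lattice-tempered window `n = n(j)` of `LOUD_j(S,E,ε)` is dense in `U` (crux #2 `DenseLoudDesignerForces` with level-uniform
viscosity floor, period and mean caps and a level-uniform parabolic-moment bound on the designer witnesses — what an explicit
construction with uniformly bounded smooth witnesses delivers), then EVERY force of `U` is loud at EVERY level: a closed set dense in
the open `U` contains `U`.  No Baire category, no genericity, no nondegeneracy, no upgrade. [folklore] -/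
theorem all_loud_of_denseLatticeTempered
    (h : ∀ S₀ : Finset (Fin 3 → ℤ), ∃ S : Finset (Fin 3 → ℤ), S₀ ⊆ S ∧ ∃ (E ε : ℝ), 0 < ε ∧
      ∃ U : Set (Coeff S), IsOpen U ∧ U.Nonempty ∧ ∀ j : ℕ, ∃ n : ℕ,
        U ⊆ closure {c : Coeff S | ∃ ν : ℝ, (1 / ((j : ℝ) + 1)) / ((n : ℝ) + 2) ≤ ν ∧
          ν ≤ (1 / ((j : ℝ) + 1)) * ((n : ℝ) + 1) / ((n : ℝ) + 2) ∧
          ∃ (τ : ℝ) (u : ℝ → 𝕋³ → ℝ³) (p : ℝ → 𝕋³ → ℝ), 1 / ((n : ℝ) + 1) ≤ τ ∧ τ ≤ (n : ℝ) + 1 ∧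
          IsClassicalNSSolutionOn Set.univ ν (fun _ => force S c) u p ∧ Function.Periodic u τ ∧
          ‖∫ x, u 0 x‖ ≤ (n : ℝ) + 1 ∧
          (∑' m : ℤ × (Fin 3 → ℤ), ENNReal.ofReal ((Λ m) ^ 3) * ‖𝐨[τ, u] m‖ₑ ^ 2) ≤ ENNReal.ofReal ((n : ℝ) + 1) ∧
          meanEnergy u ≤ E ∧ ε ≤ meanDissipation ν u}) :
    ∀ S₀ : Finset (Fin 3 → ℤ), ∃ S : Finset (Fin 3 → ℤ), S₀ ⊆ S ∧ ∃ (E ε : ℝ), 0 < ε ∧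
      ∃ U : Set (Coeff S), IsOpen U ∧ U.Nonempty ∧ ∀ j : ℕ, U ⊆ loud S (1 / ((j : ℝ) + 1)) E ε := by
  intro S₀
  obtain ⟨S, hS, E, ε, hε, U, hUo, hUne, hU⟩ := h S₀
  refine ⟨S, hS, E, ε, hε, U, hUo, hUne, fun j => ?_⟩
  obtain ⟨n, hn⟩ := hU j
  have ha : (0 : ℝ) < 1 / ((j : ℝ) + 1) := one_div_pos.2 (by positivity)
  have hK := isClosed_latticeWindow S ((1 / ((j : ℝ) + 1)) / ((n : ℝ) + 2))
    ((1 / ((j : ℝ) + 1)) * ((n : ℝ) + 1) / ((n : ℝ) + 2)) (1 / ((n : ℝ) + 1)) ((n : ℝ) + 1) ((n : ℝ) + 1) E ε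
    (div_pos ha (by positivity)) (one_div_pos.2 (by positivity))
  refine (hn.trans hK.closure_subset).trans ?_
  rw [loud_eq_iUnion_latticeWindow S E ε ha]
  exact Set.subset_iUnion (fun n : ℕ => {c : Coeff S | ∃ ν : ℝ, (1 / ((j : ℝ) + 1)) / ((n : ℝ) + 2) ≤ ν ∧
    ν ≤ (1 / ((j : ℝ) + 1)) * ((n : ℝ) + 1) / ((n : ℝ) + 2) ∧
    ∃ (τ : ℝ) (u : ℝ → 𝕋³ → ℝ³) (p : ℝ → 𝕋³ → ℝ), 1 / ((n : ℝ) + 1) ≤ τ ∧ τ ≤ (n : ℝ) + 1 ∧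
    IsClassicalNSSolutionOn Set.univ ν (fun _ => force S c) u p ∧ Function.Periodic u τ ∧
    ‖∫ x, u 0 x‖ ≤ (n : ℝ) + 1 ∧
    (∑' m : ℤ × (Fin 3 → ℤ), ENNReal.ofReal ((Λ m) ^ 3) * ‖𝐨[τ, u] m‖ₑ ^ 2) ≤ ENNReal.ofReal ((n : ℝ) + 1) ∧
    meanEnergy u ≤ E ∧ ε ≤ meanDissipation ν u}) n

/-- **R5 ⇒ the route's target**: uniformly tempered dense designer witnesses give `BaireTarget` outright (`U ⊆ LOUD_j` open ⇒
`U ⊆ interior LOUD_j ⊆ closure (interior LOUD_j)`). [folklore] -/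
theorem baireTarget_of_denseLatticeTempered
    (h : ∀ S₀ : Finset (Fin 3 → ℤ), ∃ S : Finset (Fin 3 → ℤ), S₀ ⊆ S ∧ ∃ (E ε : ℝ), 0 < ε ∧
      ∃ U : Set (Coeff S), IsOpen U ∧ U.Nonempty ∧ ∀ j : ℕ, ∃ n : ℕ,
        U ⊆ closure {c : Coeff S | ∃ ν : ℝ, (1 / ((j : ℝ) + 1)) / ((n : ℝ) + 2) ≤ ν ∧
          ν ≤ (1 / ((j : ℝ) + 1)) * ((n : ℝ) + 1) / ((n : ℝ) + 2) ∧
          ∃ (τ : ℝ) (u : ℝ → 𝕋³ → ℝ³) (p : ℝ → 𝕋³ → ℝ), 1 / ((n : ℝ) + 1) ≤ τ ∧ τ ≤ (n : ℝ) + 1 ∧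
          IsClassicalNSSolutionOn Set.univ ν (fun _ => force S c) u p ∧ Function.Periodic u τ ∧
          ‖∫ x, u 0 x‖ ≤ (n : ℝ) + 1 ∧
          (∑' m : ℤ × (Fin 3 → ℤ), ENNReal.ofReal ((Λ m) ^ 3) * ‖𝐨[τ, u] m‖ₑ ^ 2) ≤ ENNReal.ofReal ((n : ℝ) + 1) ∧
          meanEnergy u ≤ E ∧ ε ≤ meanDissipation ν u}) :
    BaireTarget := by
  obtain ⟨S, -, E, ε, hε, U, hUo, hUne, hU⟩ := all_loud_of_denseLatticeTempered h ∅
  refine ⟨S, E, ε, hε, U, hUo, hUne, fun j => ?_⟩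
  have h1 : U ⊆ interior (loud S (1 / ((j : ℝ) + 1)) E ε) := interior_maximal (hU j) hUo
  exact h1.trans subset_closure

end Summit.AnomalousDissipation.AnomalousDissipation.Theorems.RobustLoudUpgrade.Tempered

end
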